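import Mathlib
import HarnessLib
import Literature.Analysis.FluidPDE.KochTataru
import Literature.Analysis.FluidPDE.KochTataruKernel
import Literature.Analysis.FluidPDE.OseenSlice
import Literature.Analysis.FluidPDE.OseenKernelScaling
import Literature.Analysis.FluidPDE.OseenKernelJointSmooth

/-!
# Route `ThreadingFlux`, item `PoloidalLiouville` (W1, stmt-NavierStokesRegularity-1222) — crux idea «precession-gap» (ns-idea-15, sketch v3), price P1
# `OseenKernelTimeLipschitzL1`: THE OSEEN KERNEL IS TIME-LIPSCHITZ IN `L¹` WITH THE `θ^{-3/2}` RATE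

Cell ns-regularity-ideate, seat ns-poloidal-K2-p2 g12 (hand for the precession rungs; `--supports` the W1 item).  Statement = the body of
`Precession.OseenKernelTimeLipschitzL1` VERBATIM: `∃ C ≥ 0, ∀ 0 < θ ≤ θ', ∀ a b, ∫ ‖K(θ′,z)[a,b] − K(θ,z)[a,b]‖ dz ≤ C (θ′ − θ) θ^{-3/2} ‖a‖‖b‖` — the second kernel
bound of D `ShortPeriodCollapse` (the source of the `k^{-3/2}` decay over past periods).  D itself is NOT proved here.

PROOF (tree sources by name).  (W) WINDOW `½ ≤ θ ≤ θ′ ≤ 1`: `σ ↦ K(σ,z)[a,b]` is `C¹` on `σ > 0` (`contDiffAt_oseenKernelCLM_prod`) with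
`‖∂_σ K(σ,z)[a,b]‖ ≤ ‖D K(σ,z)‖ ‖a‖‖b‖ ≤ C·P(z)·‖a‖‖b‖` uniformly on the window, `P` the integrable Gaussian potential of
`exists_norm_iteratedFDeriv_oseenKernelCLM_prod_le` (`integrable_oseenKernelPotential`); the mean value inequality and `integral_mono_of_nonneg` give
`∫‖K(θ′)−K(θ)‖ ≤ C₀ (θ′ − θ) ‖a‖‖b‖`.  (N) NEAR `θ′ ≤ 2θ`: parabolic scaling `K(λ²σ, λz) = λ^{-4} K(σ,z)` (`oseenKernel_sq_mul_smul`, `λ = √θ′`) and the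
change of variables `integral_comp_smul` carry (W) to `C₀ (θ′ − θ) θ′^{-3/2} ≤ C₀ (θ′ − θ) θ^{-3/2}`.  (F) FAR `θ′ > 2θ`: the plain `L¹` bound
`∫‖K(τ)[a,b]‖ ≤ C₂ τ^{-1/2}‖a‖‖b‖` (`exists_lintegral_enorm_oseenKernel_le`) twice, and `θ^{-1/2} = θ·θ^{-3/2} ≤ (θ′ − θ) θ^{-3/2}`.

WHAT THIS IS NOT: not a claim about Navier–Stokes regularity — an S/M kernel estimate priced by ns-wall-crit-1 (V15-P1) on the path to D; rungs F/G
stay CONDITIONAL on D; items 1222 / 27585 OPEN.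
-/

noncomputable section

-- the summit and its single sub-problem share the name (CONVENTIONS §1), as in every Theorems file
set_option linter.dupNamespace false

namespace Summit.NavierStokesRegularity.NavierStokesRegularity.Theorems.ThreadingFluxPoloidalLiouvillePrecessionOseenTimeLipschitz

open MeasureTheory Set Function Filter Topology Metric
open scoped RealInnerProductSpace InnerProductSpace ENNReal
open Literature.Analysis Literature.Analysis.FluidPDE

/-- **(W) The window estimate**: for `½ ≤ θ ≤ θ′ ≤ 1`, `∫ ‖K(θ′,z)[a,b] − K(θ,z)[a,b]‖ dz ≤ C₀ (θ′ − θ) ‖a‖ ‖b‖`. [folklore] -/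
theorem exists_window_bound :
    ∃ C₀ : ℝ, 0 ≤ C₀ ∧ ∀ θ θ' : ℝ, 1 / 2 ≤ θ → θ ≤ θ' → θ' ≤ 1 → ∀ a b : EuclideanSpace ℝ (Fin 3),
      ∫ z, ‖oseenKernel θ' z a b - oseenKernel θ z a b‖ ≤ C₀ * (θ' - θ) * ‖a‖ * ‖b‖ := by
  obtain ⟨C, hC, henv⟩ := exists_norm_iteratedFDeriv_oseenKernelCLM_prod_le (E := EuclideanSpace ℝ (Fin 3)) 1
    (σa := 1 / 2) (σb := 1) (by norm_num) (by norm_num)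
  set P : EuclideanSpace ℝ (Fin 3) → ℝ := fun z => oseenKernelPotential ((1 / 2 : ℝ) / 2) (8 * (1 - (1 / 2 : ℝ) / 2)) z with hP
  have hPint : Integrable P := integrable_oseenKernelPotential (by norm_num) (by norm_num)
  have hPnn : ∀ z, 0 ≤ P z := fun z => oseenKernelPotential_nonneg (by norm_num) _ z
  have hIP : 0 ≤ ∫ z, P z := integral_nonneg hPnn
  refine ⟨C * ∫ z, P z, mul_nonneg hC hIP, ?_⟩
  intro θ θ' hθ hθθ' hθ' a b
  -- pointwise mean-value bound
  have hpt : ∀ z, ‖oseenKernel θ' z a b - oseenKernel θ z a b‖ ≤ (C * P z * ‖a‖ * ‖b‖) * (θ' - θ) := by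
    intro z
    set φ : ℝ → EuclideanSpace ℝ (Fin 3) := fun σ => oseenKernel σ z a b with hφ
    set ev : (EuclideanSpace ℝ (Fin 3) →L[ℝ] EuclideanSpace ℝ (Fin 3) →L[ℝ] EuclideanSpace ℝ (Fin 3)) →L[ℝ] EuclideanSpace ℝ (Fin 3) :=
      (ContinuousLinearMap.apply ℝ (EuclideanSpace ℝ (Fin 3)) b).comp
        (ContinuousLinearMap.apply ℝ (EuclideanSpace ℝ (Fin 3) →L[ℝ] EuclideanSpace ℝ (Fin 3)) a) with hev
    have hev_apply : ∀ M : EuclideanSpace ℝ (Fin 3) →L[ℝ] EuclideanSpace ℝ (Fin 3) →L[ℝ] EuclideanSpace ℝ (Fin 3), ev M = M a b :=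
      fun M => rfl
    set D1 : ℝ → (EuclideanSpace ℝ (Fin 3) →L[ℝ] EuclideanSpace ℝ (Fin 3) →L[ℝ] EuclideanSpace ℝ (Fin 3)) := fun σ =>
      iteratedFDeriv ℝ 1 (fun r : ℝ × EuclideanSpace ℝ (Fin 3) => oseenKernelCLM r.1 r.2) (σ, z)
        (fun _ => ((1 : ℝ), (0 : EuclideanSpace ℝ (Fin 3)))) with hD1
    set φ' : ℝ → EuclideanSpace ℝ (Fin 3) := fun σ => ev (D1 σ) with hφ'
    have hderiv : ∀ σ ∈ Icc θ θ', HasDerivWithinAt φ (φ' σ) (Icc θ θ') σ := by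
      intro σ hσ
      have hσ0 : 0 < σ := by linarith [hσ.1]
      have hq : ((σ, z) : ℝ × EuclideanSpace ℝ (Fin 3)) ∈ Ioi (0 : ℝ) ×ˢ (univ : Set (EuclideanSpace ℝ (Fin 3))) := ⟨hσ0, mem_univ _⟩
      set g : ℝ × EuclideanSpace ℝ (Fin 3) → EuclideanSpace ℝ (Fin 3) := fun r => oseenKernel r.1 r.2 a b with hg
      have hgd : DifferentiableAt ℝ g (σ, z) :=
        (((contDiffOn_oseenKernel_prod (E := EuclideanSpace ℝ (Fin 3)) a b).contDiffAt
          ((isOpen_Ioi.prod isOpen_univ).mem_nhds hq))).differentiableAt (by simp)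
      have hι : HasDerivAt (fun σ : ℝ => ((σ, z) : ℝ × EuclideanSpace ℝ (Fin 3))) ((1 : ℝ), (0 : EuclideanSpace ℝ (Fin 3))) σ :=
        (hasDerivAt_id σ).prodMk (hasDerivAt_const σ z)
      have h0 := (hgd.hasFDerivAt.comp σ hι.hasFDerivAt).hasDerivAt
      have hval : φ' σ = fderiv ℝ g (σ, z) ((1 : ℝ), (0 : EuclideanSpace ℝ (Fin 3))) := by
        simp only [hφ', hev_apply, hD1]
        rw [iteratedFDeriv_oseenKernelCLM_prod_apply 1 hq, iteratedFDeriv_one_apply]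
      have h1 : HasDerivAt (g ∘ fun σ : ℝ => ((σ, z) : ℝ × EuclideanSpace ℝ (Fin 3))) (φ' σ) σ := by
        refine h0.congr_deriv ?_
        rw [ContinuousLinearMap.comp_apply, ContinuousLinearMap.toSpanSingleton_apply, one_smul, hval]
      exact h1.hasDerivWithinAt
    have hbound : ∀ σ ∈ Icc θ θ', ‖φ' σ‖ ≤ C * P z * ‖a‖ * ‖b‖ := by
      intro σ hσ
      have hσw : σ ∈ Icc (1 / 2 : ℝ) 1 := ⟨by linarith [hσ.1], by linarith [hσ.2]⟩
      have hD : ‖D1 σ‖ ≤ C * P z := by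
        have h := henv σ hσw z
        refine (ContinuousMultilinearMap.le_opNorm _ _).trans ?_
        have hprod : ∏ i : Fin 1, ‖(fun _ : Fin 1 => ((1 : ℝ), (0 : EuclideanSpace ℝ (Fin 3)))) i‖ ≤ 1 := by
          simp [Prod.norm_def]
        calc ‖iteratedFDeriv ℝ 1 (fun r : ℝ × EuclideanSpace ℝ (Fin 3) => oseenKernelCLM r.1 r.2) (σ, z)‖ *
              ∏ i : Fin 1, ‖(fun _ : Fin 1 => ((1 : ℝ), (0 : EuclideanSpace ℝ (Fin 3)))) i‖
            ≤ (C * P z) * 1 := mul_le_mul h hprod (Finset.prod_nonneg fun i _ => norm_nonneg _) (mul_nonneg hC (hPnn z))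
          _ = C * P z := mul_one _
      have : φ' σ = (D1 σ) a b := by simp only [hφ', hev_apply]
      rw [this]
      calc ‖(D1 σ) a b‖ ≤ ‖(D1 σ) a‖ * ‖b‖ := ContinuousLinearMap.le_opNorm _ _
        _ ≤ ‖D1 σ‖ * ‖a‖ * ‖b‖ := mul_le_mul_of_nonneg_right (ContinuousLinearMap.le_opNorm _ _) (norm_nonneg _)
        _ ≤ C * P z * ‖a‖ * ‖b‖ := by gcongr
    have hmv := Convex.norm_image_sub_le_of_norm_hasDerivWithin_le hderiv hbound (convex_Icc θ θ')
      (left_mem_Icc.2 hθθ') (right_mem_Icc.2 hθθ')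
    rw [Real.norm_eq_abs, abs_of_nonneg (sub_nonneg.2 hθθ')] at hmv
    simpa [hφ] using hmv
  -- integrate
  have hg : Integrable (fun z => (C * P z * ‖a‖ * ‖b‖) * (θ' - θ)) := ((hPint.const_mul C).mul_const _ |>.mul_const _).mul_const _
  calc ∫ z, ‖oseenKernel θ' z a b - oseenKernel θ z a b‖
      ≤ ∫ z, (C * P z * ‖a‖ * ‖b‖) * (θ' - θ) :=
        integral_mono_of_nonneg (Eventually.of_forall fun z => norm_nonneg _) hg (Eventually.of_forall hpt)
    _ = C * (∫ z, P z) * (θ' - θ) * ‖a‖ * ‖b‖ := by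
        rw [integral_mul_const, integral_mul_const, integral_mul_const, integral_const_mul]; ring
    _ = C * (∫ z, P z) * (θ' - θ) * ‖a‖ * ‖b‖ := rfl

/-- **(F) The `L¹` bound of the kernel in Bochner form**: `∫ ‖K(τ,z)[a,b]‖ dz ≤ C₂ τ^{-1/2} ‖a‖ ‖b‖` (from the tree's `lintegral` form). [folklore] -/
theorem exists_l1_bound :
    ∃ C₂ : ℝ, 0 < C₂ ∧ ∀ τ : ℝ, 0 < τ → ∀ a b : EuclideanSpace ℝ (Fin 3),
      Integrable (fun z : EuclideanSpace ℝ (Fin 3) => oseenKernel τ z a b) ∧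
      ∫ z, ‖oseenKernel τ z a b‖ ≤ C₂ * τ ^ (-(1 / 2 : ℝ)) * ‖a‖ * ‖b‖ := by
  obtain ⟨C, hC, h⟩ := exists_lintegral_enorm_oseenKernel_le (E := EuclideanSpace ℝ (Fin 3))
  refine ⟨C, hC, fun τ hτ a b => ?_⟩
  obtain ⟨hint, hl⟩ := h hτ a b
  refine ⟨hint, ?_⟩
  have hnn : 0 ≤ C * τ ^ (-(1 / 2 : ℝ)) := mul_nonneg hC.le (Real.rpow_nonneg hτ.le _)
  rw [integral_norm_eq_lintegral_enorm hint.aestronglyMeasurable]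
  have hfin : ENNReal.ofReal (C * τ ^ (-(1 / 2 : ℝ))) * ‖a‖ₑ * ‖b‖ₑ ≠ ∞ :=
    ENNReal.mul_ne_top (ENNReal.mul_ne_top ENNReal.ofReal_ne_top enorm_ne_top) enorm_ne_top
  have h1 := ENNReal.toReal_mono hfin hl
  refine h1.trans (le_of_eq ?_)
  rw [ENNReal.toReal_mul, ENNReal.toReal_mul, ENNReal.toReal_ofReal hnn, toReal_enorm, toReal_enorm]

/-- `x^{-3/2} = 1/(x √x)` for `x > 0` (the companion `x^{-1/2} = 1/√x` is
`Literature.NumberTheory.Automorphic.rpow_neg_one_half_eq_one_div_sqrt`, restated inline below to keep the imports fluid-side). [folklore] -/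
theorem rpow_neg_three_halves {x : ℝ} (hx : 0 < x) : x ^ (-(3 / 2 : ℝ)) = 1 / (x * Real.sqrt x) := by
  rw [Real.rpow_neg hx.le, show (3 / 2 : ℝ) = 1 + 1 / 2 by norm_num, Real.rpow_add hx, Real.rpow_one,
    Real.sqrt_eq_rpow]
  exact (one_div _).symm

/-- **P1 `OseenKernelTimeLipschitzL1` of «precession-gap» (VERBATIM body): the Oseen kernel is time-Lipschitz in `L¹` with rate `θ^{-3/2}`.**
See the module docstring for the proof. -/
theorem oseenKernelTimeLipschitzL1 :
    ∃ C : ℝ, 0 ≤ C ∧ ∀ θ θ' : ℝ, 0 < θ → θ ≤ θ' → ∀ a b : EuclideanSpace ℝ (Fin 3),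
      ∫ z, ‖Literature.Analysis.FluidPDE.oseenKernel θ' z a b - Literature.Analysis.FluidPDE.oseenKernel θ z a b‖ ≤
        C * (θ' - θ) * θ ^ (-(3 / 2 : ℝ)) * ‖a‖ * ‖b‖ := by
  obtain ⟨C₀, hC₀, hW⟩ := exists_window_bound
  obtain ⟨C₂, hC₂, hL⟩ := exists_l1_bound
  refine ⟨max C₀ (2 * C₂), le_max_of_le_left hC₀, ?_⟩
  intro θ θ' hθ hθθ' a b
  have hθ' : 0 < θ' := lt_of_lt_of_le hθ hθθ'
  have hab : 0 ≤ ‖a‖ * ‖b‖ := mul_nonneg (norm_nonneg _) (norm_nonneg _)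
  have hsθ : 0 < Real.sqrt θ := Real.sqrt_pos.2 hθ
  have hsθ' : 0 < Real.sqrt θ' := Real.sqrt_pos.2 hθ'
  have hss : Real.sqrt θ ≤ Real.sqrt θ' := Real.sqrt_le_sqrt hθθ'
  rw [rpow_neg_three_halves hθ]
  by_cases hfar : 2 * θ < θ'
  · -- (F) far: the plain `L¹` bounds
    obtain ⟨hi', hb'⟩ := hL θ' hθ' a b
    obtain ⟨hi, hb⟩ := hL θ hθ a b
    have rpow_neg_half : ∀ {x : ℝ}, 0 < x → x ^ (-(1 / 2 : ℝ)) = 1 / Real.sqrt x := fun hx => by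
      rw [Real.rpow_neg hx.le, Real.sqrt_eq_rpow]; exact (one_div _).symm
    rw [rpow_neg_half hθ'] at hb'
    rw [rpow_neg_half hθ] at hb
    have h1 : ∫ z, ‖oseenKernel θ' z a b - oseenKernel θ z a b‖ ≤ ∫ z, (‖oseenKernel θ' z a b‖ + ‖oseenKernel θ z a b‖) :=
      integral_mono_of_nonneg (Eventually.of_forall fun z => norm_nonneg _) (hi'.norm.add hi.norm)
        (Eventually.of_forall fun z => norm_sub_le _ _)
    rw [integral_add hi'.norm hi.norm] at h1
    have h2 : C₂ * (1 / Real.sqrt θ') * ‖a‖ * ‖b‖ ≤ C₂ * (1 / Real.sqrt θ) * ‖a‖ * ‖b‖ := by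
      have : 1 / Real.sqrt θ' ≤ 1 / Real.sqrt θ := one_div_le_one_div_of_le hsθ hss
      have := mul_le_mul_of_nonneg_left this hC₂.le
      nlinarith [hab]
    -- `1/√θ = θ · (1/(θ√θ)) ≤ (θ' - θ)/(θ√θ)`
    have h3 : 2 * C₂ * (1 / Real.sqrt θ) * (‖a‖ * ‖b‖) ≤ 2 * C₂ * (θ' - θ) * (1 / (θ * Real.sqrt θ)) * (‖a‖ * ‖b‖) := by
      have hkey : 1 / Real.sqrt θ ≤ (θ' - θ) * (1 / (θ * Real.sqrt θ)) := by
        rw [one_div, one_div, ← div_eq_mul_inv, le_div_iff₀ (mul_pos hθ hsθ)]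
        field_simp
        nlinarith
      have := mul_le_mul_of_nonneg_left hkey (by positivity : (0 : ℝ) ≤ 2 * C₂)
      have := mul_le_mul_of_nonneg_right this hab
      linarith
    calc ∫ z, ‖oseenKernel θ' z a b - oseenKernel θ z a b‖
        ≤ C₂ * (1 / Real.sqrt θ') * ‖a‖ * ‖b‖ + C₂ * (1 / Real.sqrt θ) * ‖a‖ * ‖b‖ := h1.trans (add_le_add hb' hb)
      _ ≤ 2 * C₂ * (1 / Real.sqrt θ) * (‖a‖ * ‖b‖) := by linarith
      _ ≤ 2 * C₂ * (θ' - θ) * (1 / (θ * Real.sqrt θ)) * (‖a‖ * ‖b‖) := h3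
      _ ≤ max C₀ (2 * C₂) * (θ' - θ) * (1 / (θ * Real.sqrt θ)) * ‖a‖ * ‖b‖ := by
          have h4 : 2 * C₂ ≤ max C₀ (2 * C₂) := le_max_right _ _
          have h5 : 0 ≤ (θ' - θ) * (1 / (θ * Real.sqrt θ)) * (‖a‖ * ‖b‖) :=
            mul_nonneg (mul_nonneg (sub_nonneg.2 hθθ') (by positivity)) hab
          nlinarith
  · -- (N) near: parabolic scaling to the window `[1/2, 1]`
    push Not at hfar
    set lam : ℝ := Real.sqrt θ' with hlam
    have hlam0 : 0 < lam := hsθ'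
    have hlam2 : lam ^ 2 = θ' := Real.sq_sqrt hθ'.le
    set σ : ℝ := θ / θ' with hσ
    have hσpos : 0 < σ := div_pos hθ hθ'
    have hσ1 : σ ≤ 1 := (div_le_one hθ').2 hθθ'
    have hσhalf : 1 / 2 ≤ σ := by rw [hσ, le_div_iff₀ hθ']; linarith
    have hfr : Module.finrank ℝ (EuclideanSpace ℝ (Fin 3)) = 3 := finrank_euclideanSpace_fin
    -- the scaled kernels
    have hscale : ∀ (τ : ℝ), 0 < τ → ∀ z : EuclideanSpace ℝ (Fin 3),
        oseenKernel (lam ^ 2 * τ) z a b = (lam ^ 4)⁻¹ • oseenKernel τ (lam⁻¹ • z) a b := by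
      intro τ hτ z
      have h := oseenKernel_sq_mul_smul hlam0 hτ (lam⁻¹ • z) a b
      rw [smul_inv_smul₀ hlam0.ne', hfr] at h
      exact h
    have hθ'eq : θ' = lam ^ 2 * 1 := by rw [mul_one, hlam2]
    have hθeq : θ = lam ^ 2 * σ := by rw [hlam2, hσ, mul_div_cancel₀ _ hθ'.ne']
    set F : EuclideanSpace ℝ (Fin 3) → ℝ := fun w => ‖oseenKernel 1 w a b - oseenKernel σ w a b‖ with hF
    have hpt : ∀ z, ‖oseenKernel θ' z a b - oseenKernel θ z a b‖ = (lam ^ 4)⁻¹ * F (lam⁻¹ • z) := by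
      intro z
      rw [hθ'eq, hθeq, hscale 1 one_pos z, hscale σ hσpos z, ← smul_sub, norm_smul, Real.norm_eq_abs,
        abs_of_pos (by positivity)]
    have hint_eq : ∫ z, ‖oseenKernel θ' z a b - oseenKernel θ z a b‖ = lam⁻¹ * ∫ w, F w := by
      simp_rw [hpt]
      rw [integral_const_mul, Measure.integral_comp_smul volume F lam⁻¹, hfr, smul_eq_mul]
      rw [inv_pow, inv_inv, abs_of_pos (pow_pos hlam0 3)]
      field_simp
    have hwin := hW σ 1 hσhalf hσ1 le_rfl a b
    rw [hint_eq]
    -- `lam⁻¹ · C₀ (1 - σ) ≤ C (θ' - θ)/(θ√θ)`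
    have hC0le : C₀ ≤ max C₀ (2 * C₂) := le_max_left _ _
    have hkey : lam⁻¹ * (C₀ * (1 - σ) * ‖a‖ * ‖b‖) ≤ max C₀ (2 * C₂) * (θ' - θ) * (1 / (θ * Real.sqrt θ)) * ‖a‖ * ‖b‖ := by
      have e1 : lam⁻¹ * (1 - σ) = (θ' - θ) * (1 / (θ' * Real.sqrt θ')) := by
        rw [hσ, hlam]; field_simp
      have e2 : 1 / (θ' * Real.sqrt θ') ≤ 1 / (θ * Real.sqrt θ) :=
        one_div_le_one_div_of_le (mul_pos hθ hsθ) (mul_le_mul hθθ' hss hsθ.le hθ'.le)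
      have h1 : lam⁻¹ * (C₀ * (1 - σ) * ‖a‖ * ‖b‖) = C₀ * ((θ' - θ) * (1 / (θ' * Real.sqrt θ'))) * (‖a‖ * ‖b‖) := by
        rw [← e1]; ring
      rw [h1]
      have h2 : (θ' - θ) * (1 / (θ' * Real.sqrt θ')) ≤ (θ' - θ) * (1 / (θ * Real.sqrt θ)) :=
        mul_le_mul_of_nonneg_left e2 (sub_nonneg.2 hθθ')
      have h3 : 0 ≤ (θ' - θ) * (1 / (θ * Real.sqrt θ)) := mul_nonneg (sub_nonneg.2 hθθ') (by positivity)
      calc C₀ * ((θ' - θ) * (1 / (θ' * Real.sqrt θ'))) * (‖a‖ * ‖b‖)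
          ≤ C₀ * ((θ' - θ) * (1 / (θ * Real.sqrt θ))) * (‖a‖ * ‖b‖) := by gcongr
        _ ≤ max C₀ (2 * C₂) * ((θ' - θ) * (1 / (θ * Real.sqrt θ))) * (‖a‖ * ‖b‖) := by gcongr
        _ = max C₀ (2 * C₂) * (θ' - θ) * (1 / (θ * Real.sqrt θ)) * ‖a‖ * ‖b‖ := by ring
    exact (mul_le_mul_of_nonneg_left hwin (inv_nonneg.2 hlam0.le)).trans hkey

end Summit.NavierStokesRegularity.NavierStokesRegularity.Theorems.ThreadingFluxPoloidalLiouvillePrecessionOseenTimeLipschitz
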